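import Literature.Computability.Cryptography.ChenQuantumLWELineInvariants
import Literature.Computability.Cryptography.ChenQuantumLWEWindowProfile

/-!
# Non-disturbing computational-basis measurements of a line ket are exactly the line invariants (T4, last modelling step)

REPRODUCTION / ANALYSIS OF A CLAIMED RESULT UNDER ADJUDICATION (withdrawn): Yilei Chen, *Quantum
Algorithms for Lattice Problems*, IACR ePrint 2024/555, version of 2024-04-18 [ChenQuantumLattice2024]
(the version carrying the author's note that Step 9 contains a bug), Step 9 (§3.5.9, pp. 34–38) acting
on the line ket `|φ8.b⟩ = Σ_{j ∈ ℤ_P} e(-j²/P) |2D²j·b + v′ mod N⟩` (p. 35).  Bundle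
`papers/QuantumAdvantage/lwe-quantum-autopsy/`, Part 2 (`REPAIR-CENSUS.md` §1 **T4**, §9, §11),
sequel of `ChenQuantumLWELineInvariants.lean`.
HONEST FRAMING: kernel-checked THEOREMS about states occurring in a WITHDRAWN algorithm — the last
modelling step of a NO-GO for in-run repairs of Step 9, NOT summit progress, no cryptanalytic claim in
either direction, no new algorithm; quantum lower bounds are out of scope.

## What is proved

`ChenQuantumLWELineInvariants` showed: the LINE INVARIANTS (register functions constant along the line
of every class secret and every offset) together with the Step-8 datum determine the offset exactly up
to class shifts (`offset_indistinguishable_iff`).  The remaining modelling sentence of the census was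
"the secret-free information a run offers about its offset WITHOUT DESTROYING THE STATE is its
line-invariant content".  For computational-basis measurements this is now a theorem:

* `ptB_injective` — for odd `P` and `b₀ = −1` the `P` points `2D²j·b + v′ (mod N)` of the line are
  pairwise distinct; `lineKet_apply_pt`, `lineKet_apply_of_ne` — a line ket takes the value `c(j)` at
  the `j`-th point and `0` off the line.
* `IsNonDisturbing M ψ` — the `M`-branch of the computational-basis measurement `{M, Mᶜ}` leaves the
  ray of `ψ` unchanged or annihilates it: `𝟙_M·ψ = λψ` for some `λ`.
* **`isNonDisturbing_profileKet_iff`** — for a profile `c` that vanishes nowhere (Chen's chirp: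
  `|ψ_P(−j²)| = 1`), `{M, Mᶜ}` does not disturb the line ket `Σ_j c(j)|2D²j·b + v′⟩` iff the line lies
  inside `M` or inside `Mᶜ`.
* **`isLineInvariant_mem_iff_nonDisturbing`** — hence a set `M` of register values is non-disturbing
  for EVERY class secret `b` (`b = bk` off `U`, `2p₁ ∣ b` on `U`) and EVERY offset iff membership in
  `M` is a LINE INVARIANT; and **`nonDisturbing_outcome_classShift`** — the bit such a measurement
  reveals (`[v′ ∈ M]`, since the line passes through `v′` at `j = 0`) is the same for `v′` and for
  every class-shifted offset `v′ + D²p₁(a·bk + c·𝟙_U)`: it cannot contribute to the centre correction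
  (`ChenQuantumLWEClassTwirl`: `centreError` is moved through all of `ℤ_Q` by the class shifts).

## What is NOT here

General (non-diagonal) POVMs — covered by the class-twirl theorem `twirl_statistic_indep` of
`ChenQuantumLWEClassTwirl` for processing in the commuting class `K`; profiles with zeros (a windowed
chirp admits more non-disturbing sets, all of which still only see the window's own position); the
bookkeeping that Claim 3.14 is the only other offset source in Steps 1–8 (census T6).
-/

namespace Literature.Computability.Cryptography.Chen2024

open scoped BigOperators

/-! ### Line kets at and off their points -/

/-- A line ket with pairwise distinct points takes the value `c j` at its `j`-th point. [folklore] -/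
theorem lineKet_apply_pt {ι : Type*} [Fintype ι] {k m : ℕ} {pt : ι → (Fin k → ZMod m)}
    (hpt : Function.Injective pt) (c : ι → ℂ) (j : ι) : lineKet pt c (pt j) = c j := by
  classical
  unfold lineKet
  rw [Finset.sum_eq_single j (fun j' _ hj' => if_neg fun h => hj' (hpt h).symm)
    (fun h => absurd (Finset.mem_univ j) h), if_pos rfl]

/-- A line ket vanishes off its points. [folklore] -/
theorem lineKet_apply_of_ne {ι : Type*} [Fintype ι] {k m : ℕ} (pt : ι → (Fin k → ZMod m))
    (c : ι → ℂ) {z : Fin k → ZMod m} (hz : ∀ j, z ≠ pt j) : lineKet pt c z = 0 :=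
  Finset.sum_eq_zero fun j _ => if_neg (hz j)

/-- The `M`-branch of the computational-basis measurement `{M, Mᶜ}` does NOT DISTURB `ψ`: the projected
state `𝟙_M·ψ` is proportional to `ψ` (then so is `𝟙_{Mᶜ}·ψ = ψ − 𝟙_M·ψ`). [folklore] -/
def IsNonDisturbing {k m : ℕ} (M : Set (Fin k → ZMod m)) (ψ : Ket k m) : Prop :=
  ∃ l : ℂ, M.indicator ψ = l • ψ

section Line

variable (n : ℕ) (D p₁ Q : ℕ+) (b v' : Fin (n + 1) → ℤ)

/-- **The points of the line are distinct**: for odd `P` and `b₀ = −1`, `j ↦ 2D²j·b + v′ (mod N)` is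
injective on `ℤ_P` (coordinate `0` already separates: `−2D²(j − j′) ≡ 0 (mod D²P)` forces
`P ∣ 2(j − j′)`). [cite: ChenQuantumLattice2024, §3.5.9 p. 35, eq. (12) p. 17] -/
theorem ptB_injective (hP : Odd ((p₁ * Q : ℕ+) : ℕ)) (hb : b 0 = -1) :
    Function.Injective (ptB n D p₁ Q b v') := by
  intro j j' h
  have h0 : ptB n D p₁ Q b v' j 0 = ptB n D p₁ Q b v' j' 0 := by rw [h]
  simp only [ptB, hb] at h0
  rw [ZMod.intCast_eq_intCast_iff_dvd_sub] at h0
  have hD : ((D : ℕ) : ℤ) * ((D : ℕ) : ℤ) ≠ 0 := by positivity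
  have h1 : (((p₁ * Q : ℕ+) : ℕ) : ℤ) ∣ 2 * ((j.val : ℤ) - (j'.val : ℤ)) := by
    rw [← mul_dvd_mul_iff_left hD]
    have e1 : (((D * D * (p₁ * Q) : ℕ+) : ℕ) : ℤ)
        = ((D : ℕ) : ℤ) * ((D : ℕ) : ℤ) * (((p₁ * Q : ℕ+) : ℕ) : ℤ) := by push_cast; ring
    have e2 : (2 * ((D : ℕ) : ℤ) ^ 2 * ((j'.val : ℕ) : ℤ) * (-1) + v' 0)
        - (2 * ((D : ℕ) : ℤ) ^ 2 * ((j.val : ℕ) : ℤ) * (-1) + v' 0)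
        = ((D : ℕ) : ℤ) * ((D : ℕ) : ℤ) * (2 * ((j.val : ℤ) - (j'.val : ℤ))) := by ring
    rwa [e1, e2] at h0
  have hcop : IsCoprime (((p₁ * Q : ℕ+) : ℕ) : ℤ) 2 := by
    have := Nat.isCoprime_iff_coprime.2 (Nat.coprime_two_right.2 hP)
    simpa using this
  have h2 : (((p₁ * Q : ℕ+) : ℕ) : ℤ) ∣ (j.val : ℤ) - (j'.val : ℤ) := hcop.dvd_of_dvd_mul_left h1
  have h3 : (((j'.val : ℕ) : ℤ) : ZP p₁ Q) = (((j.val : ℕ) : ℤ) : ZP p₁ Q) :=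
    (ZMod.intCast_eq_intCast_iff_dvd_sub _ _ _).2 h2
  rw [Int.cast_natCast, Int.cast_natCast, ZMod.natCast_zmod_val, ZMod.natCast_zmod_val] at h3
  exact h3.symm

/-- The line ket's value at its `j`-th point is `c j` (odd `P`, `b₀ = −1`). [folklore] -/
theorem profileKet_apply_ptB (hP : Odd ((p₁ * Q : ℕ+) : ℕ)) (hb : b 0 = -1) (c : ZP p₁ Q → ℂ)
    (j : ZP p₁ Q) : profileKet n D p₁ Q b v' c (ptB n D p₁ Q b v' j) = c j :=
  lineKet_apply_pt (ptB_injective n D p₁ Q b v' hP hb) c j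

/-- **Non-disturbing ⇔ the line lies inside `M` or inside `Mᶜ`.** For odd `P`, `b₀ = −1` and a profile
vanishing nowhere, the computational-basis measurement `{M, Mᶜ}` does not disturb the line ket
`Σ_j c(j)|2D²j·b + v′⟩` iff all its points lie in `M` or all lie outside `M`.
[cite: ChenQuantumLattice2024, §3.5.9 p. 35; folklore] -/
theorem isNonDisturbing_profileKet_iff (hP : Odd ((p₁ * Q : ℕ+) : ℕ)) (hb : b 0 = -1)
    (c : ZP p₁ Q → ℂ) (hc : ∀ j, c j ≠ 0) (M : Set (Fin (n + 1) → ZN D p₁ Q)) :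
    IsNonDisturbing M (profileKet n D p₁ Q b v' c)
      ↔ (∀ j, ptB n D p₁ Q b v' j ∈ M) ∨ (∀ j, ptB n D p₁ Q b v' j ∉ M) := by
  have hval := profileKet_apply_ptB n D p₁ Q b v' hP hb c
  constructor
  · rintro ⟨l, hl⟩
    have hpt : ∀ j, M.indicator (profileKet n D p₁ Q b v' c) (ptB n D p₁ Q b v' j) = l * c j := by
      intro j
      have := congr_fun hl (ptB n D p₁ Q b v' j)
      rwa [Pi.smul_apply, smul_eq_mul, hval] at this
    by_contra hcon
    obtain ⟨h1, h2⟩ := not_or.1 hcon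
    obtain ⟨j₁, hj₁⟩ := not_forall.1 h1
    obtain ⟨j₂, hj₂'⟩ := not_forall.1 h2
    have hj₂ : ptB n D p₁ Q b v' j₂ ∈ M := not_not.1 hj₂'
    have e1 := hpt j₁
    rw [Set.indicator_of_notMem hj₁] at e1
    have e2 := hpt j₂
    rw [Set.indicator_of_mem hj₂, hval] at e2
    have hl0 : l = 0 := by
      rcases mul_eq_zero.1 e1.symm with h | h
      · exact h
      · exact absurd h (hc j₁)
    rw [hl0, zero_mul] at e2
    exact hc j₂ e2
  · rintro (hall | hnone)
    · refine ⟨1, ?_⟩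
      rw [one_smul]
      funext z
      by_cases hz : z ∈ M
      · exact Set.indicator_of_mem hz _
      · rw [Set.indicator_of_notMem hz]
        exact (lineKet_apply_of_ne (ptB n D p₁ Q b v') c (z := z) fun j h => hz (h ▸ hall j)).symm
    · refine ⟨0, ?_⟩
      rw [zero_smul]
      funext z
      by_cases hz : z ∈ M
      · rw [Set.indicator_of_mem hz, Pi.zero_apply]
        exact lineKet_apply_of_ne (ptB n D p₁ Q b v') c fun j h => hnone j (h ▸ hz)
      · rw [Set.indicator_of_notMem hz, Pi.zero_apply]

end Line

/-! ### Non-disturbing for the whole class ⇔ line invariant -/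

section Class

variable (n : ℕ) (D p₁ Q : ℕ+)

/-- Every class secret has `b₀ = −1` when `0 ∉ U` and `bk₀ = −1`. [cite: ChenQuantumLattice2024, eq. (12) p. 17] -/
theorem InClass.apply_zero {U : Finset (Fin (n + 1))} (hU : (0 : Fin (n + 1)) ∉ U)
    {bk b : Fin (n + 1) → ℤ} (hbk0 : bk 0 = -1) (h : InClass n p₁ U bk b) : b 0 = -1 := by
  rw [h.1 0 hU, hbk0]

/-- **Non-disturbing for every class secret and every offset ⇔ membership is a line invariant.**
For odd `P`, `0 ∉ U`, `bk₀ = −1` and a profile vanishing nowhere: the computational-basis measurement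
`{M, Mᶜ}` disturbs no line ket `Σ_j c(j)|2D²j·b + v′⟩` (`b` in the class, `v′` arbitrary) iff
`x ↦ [x ∈ M]` is a line invariant. [cite: ChenQuantumLattice2024, §3.5.9 p. 35, eq. (12) p. 17] -/
theorem isLineInvariant_mem_iff_nonDisturbing (hP : Odd ((p₁ * Q : ℕ+) : ℕ))
    (U : Finset (Fin (n + 1))) (hU : (0 : Fin (n + 1)) ∉ U) (bk : Fin (n + 1) → ℤ) (hbk0 : bk 0 = -1)
    (c : ZP p₁ Q → ℂ) (hc : ∀ j, c j ≠ 0) (M : Set (Fin (n + 1) → ZN D p₁ Q)) :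
    IsLineInvariant n D p₁ Q U bk (fun x => x ∈ M)
      ↔ ∀ b, InClass n p₁ U bk b → ∀ v' : Fin (n + 1) → ℤ,
          IsNonDisturbing M (profileKet n D p₁ Q b v' c) := by
  constructor
  · intro hf b hb v'
    rw [isNonDisturbing_profileKet_iff n D p₁ Q b v' hP (InClass.apply_zero n p₁ hU hbk0 hb) c hc M]
    by_cases h0 : ptB n D p₁ Q b v' 0 ∈ M
    · exact Or.inl fun j => (hf b hb v' j 0).mpr h0
    · exact Or.inr fun j hj => h0 ((hf b hb v' j 0).mp hj)
  · intro h b hb v' j j'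
    rcases (isNonDisturbing_profileKet_iff n D p₁ Q b v' hP (InClass.apply_zero n p₁ hU hbk0 hb)
        c hc M).1 (h b hb v') with hall | hnone
    · exact propext ⟨fun _ => hall j', fun _ => hall j⟩
    · exact propext ⟨fun hj => absurd hj (hnone j), fun hj' => absurd hj' (hnone j')⟩

/-- **What a non-disturbing measurement reveals is blind to class shifts.** If `{M, Mᶜ}` disturbs no
line ket of the class (odd `P`, odd `Q`, `0 ∉ U`, `bk₀ = −1`, `2p₁ ∣ bk` on `U`, profile vanishing
nowhere), then its outcome bit at offset `v′` — `[v′ ∈ M]`, the line passing through `v′` at `j = 0` —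
equals its outcome bit at every class-shifted offset `v′ + D²p₁(a·bk + c·𝟙_U)`.
[cite: ChenQuantumLattice2024, §3.5.9 p. 35, Claim 3.14 pp. 33–34] -/
theorem nonDisturbing_outcome_classShift (hP : Odd ((p₁ * Q : ℕ+) : ℕ)) (hQ : Odd ((Q : ℕ+) : ℕ))
    (U : Finset (Fin (n + 1))) (hU : (0 : Fin (n + 1)) ∉ U) (bk : Fin (n + 1) → ℤ) (hbk0 : bk 0 = -1)
    (hbk : ∀ i, i ∈ U → (2 * ((p₁ : ℕ) : ℤ)) ∣ bk i) (c : ZP p₁ Q → ℂ) (hc : ∀ j, c j ≠ 0)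
    (M : Set (Fin (n + 1) → ZN D p₁ Q))
    (hM : ∀ b, InClass n p₁ U bk b → ∀ v' : Fin (n + 1) → ℤ,
      IsNonDisturbing M (profileKet n D p₁ Q b v' c))
    (v' : Fin (n + 1) → ℤ) (a : ZQ Q) (cc : Fin (n + 1) → ZQ Q) :
    (fun i => ((v' i + classShift n D p₁ Q U bk a cc i : ℤ) : ZN D p₁ Q)) ∈ M
      ↔ (fun i => ((v' i : ℤ) : ZN D p₁ Q)) ∈ M :=
  Iff.of_eq (((isLineInvariant_mem_iff_nonDisturbing n D p₁ Q hP U hU bk hbk0 c hc M).2 hM).apply_classShift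
    n D p₁ Q hQ hbk v' a cc)

open scoped Classical in
/-- The outcome bit of a non-disturbing measurement at offset `v′` is `[v′ ∈ M]`: the `M`-branch keeps
the whole state (`λ = 1`) iff `v′ (mod N) ∈ M`, else annihilates it. [folklore] -/
theorem nonDisturbing_branch (b v' : Fin (n + 1) → ℤ) (hP : Odd ((p₁ * Q : ℕ+) : ℕ)) (hb : b 0 = -1)
    (c : ZP p₁ Q → ℂ) (hc : ∀ j, c j ≠ 0) (M : Set (Fin (n + 1) → ZN D p₁ Q))
    (hM : IsNonDisturbing M (profileKet n D p₁ Q b v' c)) :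
    M.indicator (profileKet n D p₁ Q b v' c)
      = if (fun i => ((v' i : ℤ) : ZN D p₁ Q)) ∈ M then profileKet n D p₁ Q b v' c else 0 := by
  have h0 : ptB n D p₁ Q b v' 0 = fun i => ((v' i : ℤ) : ZN D p₁ Q) := ptB_zero n D p₁ Q b v'
  rcases (isNonDisturbing_profileKet_iff n D p₁ Q b v' hP hb c hc M).1 hM with hall | hnone
  · rw [if_pos (h0 ▸ hall 0)]
    funext z
    by_cases hz : z ∈ M
    · exact Set.indicator_of_mem hz _
    · rw [Set.indicator_of_notMem hz]
      exact (lineKet_apply_of_ne (ptB n D p₁ Q b v') c (z := z) fun j h => hz (h ▸ hall j)).symm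
  · rw [if_neg (h0 ▸ hnone 0)]
    funext z
    by_cases hz : z ∈ M
    · rw [Set.indicator_of_mem hz, Pi.zero_apply]
      exact lineKet_apply_of_ne (ptB n D p₁ Q b v') c fun j h => hnone j (h ▸ hz)
    · rw [Set.indicator_of_notMem hz, Pi.zero_apply]

/-- Chen's chirp profile vanishes nowhere. [folklore] -/
theorem chirp_ne_zero (j : ZP p₁ Q) : (ZMod.stdAddChar (-(j ^ 2) : ZP p₁ Q) : ℂ) ≠ 0 := by
  intro h
  have := congrArg norm h
  rw [ZMod.stdAddChar_apply, Circle.norm_coe, norm_zero] at this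
  exact one_ne_zero this

end Class

end Literature.Computability.Cryptography.Chen2024
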